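import Summits.CriticalPhenomena.PercolationContinuityZ3.Theorems.PercNearOneGluingNoHeavyQuantReflectionGates
import Summits.CriticalPhenomena.PercolationContinuityZ3.Theorems.PercNearOneGluingNoHeavyQuantShapeHubBlobLaw
import HarnessLib

/-!
# QUANT lane R8, T-DEC: THE POISSON RATIO BOUND FOR EQUAL-SIZE BLOB LAWS (lists) — `ΣG · P_G(b) ≤ (b+1)·P_G(b+1)` for `b + 1 ≤ ΣG`, any gates in
# `[0,1]`; hence for the masses of the sub-floor hub of shape `(lo, K)` (census-1 gen 35)

builds on p205010 (kernel theorem, internal audit signed; external expert review pending)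

Support file (`--supports stmt-CriticalPhenomena-4575`), QUANT lane seat prim-quant-census-1 (gen 35); memo
`run/shared/lean/prim/quant/prim-quant-census-1/g35/QUADHUB-G35.md` §4 (2).  Theorems only (no definitions), standard axioms, no sorries.  The list /
`blobLaw` twin of census-2 g33's `pb_ratio` (`…QuantPoissonBinomialRatio`, `prodBernoulli` formalism): for a Poisson-binomial variable with mean `U` the
point masses increase at least at the Poisson rate below the mean, `U·P(b) ≤ (b+1)·P(b+1)` whenever `b+1 ≤ U` — here for census-2's `blobLaw` of equal-size
blobs `(k, g)`, `g ∈ G` (notation `P_G(b) = blobLaw (G.map (k,·)) (b·k)` of `…QuantBlobLawSizeBias`), with NO restriction on the gates beyond `[0,1]`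
(census-2's `pb_ratio_mono` needs gates `≥ 1/2`).  Proof: strong induction on `|G|` through census-2's size-bias identity `pb_size_bias_succ`
(`(b+1)P_G(b+1) = Σ_m g_m P_{G∖m}(b)`) and the one-gate decomposition `P_G(b+1) = (1−g_m)P_{G∖m}(b+1) + g_m P_{G∖m}(b)`: termwise `P_G(b) ≤ P_{G∖m}(b)`
because `P_{G∖m}(b−1) ≤ P_{G∖m}(b)` by the induction hypothesis (`Σ(G∖m) ≥ U − 1 ≥ b`).  With this generation's bridge `sHub_atom_eq_pb`
(`…QuantShapeHubBlobLaw`) it is the success-side capacity tool for the every-width long-tail hub (memo §4 (2): for widths `j ≥ 8` the targets of the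
uniform rule satisfy `t ≤ ⌊d⌋+2 ≤ Σγᵢ`).
* **`pb_mean_ratio`** — `(ΣG)·P_G(b) ≤ (b+1)·P_G(b+1)` for gates in `[0,1]`, `b+1 ≤ ΣG` (`k ≥ 1`).
* **`pb_mono_below_mean`** — `P_G(b) ≤ P_G(b+1)` for `b+1 ≤ ΣG`.
* **`sHub_mean_ratio`** — the same for the hub masses: `(Σγᵢ)·u(lo·j + K·b) ≤ (b+1)·u(lo·j + K·(b+1))`, `b+1 ≤ Σγᵢ`.
* **`pb_fail_odds_ratio`** / **`sHub_fail_odds_ratio`** (appended) — the failure-side companion: `(n−b)·P_G(b) ≤ (Σ(1−gᵢ)/gᵢ)·P_G(b+1)` for every `b`,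
  gates in `(0,1]` (failure size-bias).

HONEST STATUS.  Tool; `SiblingStep`, `GluedDominatedMass`, `SDECConvClosed`, `FarTreeRow` OPEN; RATE class (log\*) / honest sentence of
`run/shared/lean/prim/quant/README.md` unchanged.  [this work]; the inequality is classical for Poisson-binomial laws (monotonicity of the pmf below
the mean) [folklore].  Nothing here is cited as a published result.  The gluing rows served [cite: KozmaNitzan2024, Conjecture 3 (p. 15)]; product
measure [cite: Grimmett1999, §1.3 p. 10].
-/

noncomputable section

open scoped BigOperators

namespace Summit.CriticalPhenomena.PercolationContinuityZ3.Theorems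
namespace Quant

open Finset

/-- the Poisson-binomial point mass `P_G(j)`: the law of the blobs `(k, g)`, `g ∈ G`, at the atom `j·k` -/
local notation3 "PB[" k ", " G ", " j "]" => LawDec.blobLaw (List.map (fun g : ℝ => ((k : ℕ), g)) G) ((j : ℕ) * (k : ℕ))

namespace LawDec

/-! ### The Poisson ratio bound below the mean -/

/-- **THE POISSON RATIO BOUND (lists).**  Gates `G` in `[0,1]`, `k ≥ 1`, `U = ΣG`: for every `b` with `b + 1 ≤ U`,
`U·P_G(b) ≤ (b+1)·P_G(b+1)`.  Strong induction on `|G|` via the size-bias identity. [this work] -/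
theorem pb_mean_ratio (k : ℕ) (hk : 0 < k) : ∀ (n : ℕ) (G : List ℝ), G.length = n → (∀ g ∈ G, 0 ≤ g ∧ g ≤ 1) →
    ∀ b : ℕ, (b : ℝ) + 1 ≤ G.sum → G.sum * PB[k, G, b] ≤ ((b : ℝ) + 1) * PB[k, G, b + 1] := by
  intro n
  induction n using Nat.strong_induction_on with
  | _ n ih =>
    intro G hlen hG b hb
    -- size bias: `(b+1)·P_G(b+1) = Σ_m g_m P_{G∖m}(b)`; and `ΣG = Σ_m g_m`
    rw [← pb_size_bias_succ k hk G b, ← sum_get_eq_sum G, Finset.sum_mul]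
    refine Finset.sum_le_sum fun m _ => mul_le_mul_of_nonneg_left ?_ (hG _ (List.get_mem G m)).1
    -- termwise: `P_G(b) ≤ P_{G∖m}(b)`
    have hperm := perm_get_cons_eraseIdx G m
    set W : List ℝ := G.eraseIdx m with hW
    have hgm := hG _ (List.get_mem G m)
    have hWg : ∀ g ∈ W, 0 ≤ g ∧ g ≤ 1 := fun g hg => hG g (by rw [hW] at hg; exact List.mem_of_mem_eraseIdx hg)
    have hWlen : W.length < n := by
      rw [hW, List.length_eraseIdx]; have := m.2; simp only [hlen] at this ⊢; rw [if_pos this]; omega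
    have hWsum : G.sum = G.get m + W.sum := by rw [hperm.sum_eq, List.sum_cons]
    rw [blobLaw_perm (hperm.map _), List.map_cons]
    cases b with
    | zero =>
      have e := pb_cons_zero k hk (G.get m) W
      rw [List.map_cons] at e
      rw [e]
      have h0 := pb_nonneg k W hWg 0
      nlinarith [hgm.1]
    | succ b =>
      have e := pb_cons_succ k (G.get m) W b
      rw [List.map_cons] at e
      rw [e]
      -- `P_W(b) ≤ P_W(b+1)` by the induction hypothesis (`ΣW ≥ U − 1 ≥ b + 1`)
      have hbW : (b : ℝ) + 1 ≤ W.sum := by push_cast at hb; linarith [hgm.2]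
      have hIH := ih W.length hWlen W rfl hWg b hbW
      have hPb := pb_nonneg k W hWg b
      have hmono : PB[k, W, b] ≤ PB[k, W, b + 1] := by
        have h1 : ((b : ℝ) + 1) * PB[k, W, b] ≤ ((b : ℝ) + 1) * PB[k, W, b + 1] :=
          le_trans (mul_le_mul_of_nonneg_right hbW hPb) hIH
        exact le_of_mul_le_mul_left h1 (by positivity)
      nlinarith [hgm.1]

/-- **the pmf is non-decreasing below the mean**: `P_G(b) ≤ P_G(b+1)` for `b + 1 ≤ ΣG`. [this work] -/
theorem pb_mono_below_mean (k : ℕ) (hk : 0 < k) (G : List ℝ) (hG : ∀ g ∈ G, 0 ≤ g ∧ g ≤ 1) (b : ℕ) (hb : (b : ℝ) + 1 ≤ G.sum) :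
    PB[k, G, b] ≤ PB[k, G, b + 1] := by
  have h := pb_mean_ratio k hk G.length G rfl hG b hb
  have hPb := pb_nonneg k G hG b
  have h1 : ((b : ℝ) + 1) * PB[k, G, b] ≤ ((b : ℝ) + 1) * PB[k, G, b + 1] := le_trans (mul_le_mul_of_nonneg_right hb hPb) h
  exact le_of_mul_le_mul_left h1 (by positivity)

/-! ### For the sub-floor hub of shape `(lo, K)` -/

/-- **THE POISSON RATIO BOUND FOR HUB MASSES**: for the hub `sHub lo K P` (`lo < K`, gates in `[0,1]`), `Λ = ΣP`, and `b + 1 ≤ Λ`: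
`Λ·u(lo·|P| + K·b) ≤ (b+1)·u(lo·|P| + K·(b+1))` (via `sHub_atom_eq_pb`). [this work] -/
theorem sHub_mean_ratio (lo K : ℕ) (hloK : lo < K) (P : List ℝ) (hP : ∀ γ ∈ P, 0 ≤ γ ∧ γ ≤ 1) (b : ℕ) (hb : (b : ℝ) + 1 ≤ P.sum) :
    P.sum * sHub lo K P (lo * P.length + K * b) ≤ ((b : ℝ) + 1) * sHub lo K P (lo * P.length + K * (b + 1)) := by
  have hK : 0 < K := lt_of_le_of_lt (Nat.zero_le lo) hloK
  rw [sHub_atom_eq_pb lo K hloK P hP b, sHub_atom_eq_pb lo K hloK P hP (b + 1)]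
  exact pb_mean_ratio K hK P.length P rfl hP b hb

/-! ### The odds bound above (appended, same seat): one step down in the success count costs at most the total failure odds -/

/-- **THE FAILURE-ODDS RATIO BOUND.**  Gates `G` in `(0,1]`, `k ≥ 1`, `n = |G|`: for every `b`,
`(n − b)·P_G(b) ≤ (Σ_m (1−g_m)/g_m)·P_G(b+1)` — by the failure size-bias identity `(n−b)P_G(b) = Σ_m (1−g_m)·P_{G∖m}(b)` and
`P_{G∖m}(b) ≤ P_G(b+1)/g_m` (from `P_G(b+1) = g_m·P_{G∖m}(b) + (1−g_m)·P_{G∖m}(b+1)`).  In failure terms (`N′ = n − N`): `(a+1)·P(N′ = a+1) ≤ e₁(r)·P(N′ = a)`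
with the failure odds `rᵢ = (1−gᵢ)/gᵢ` — the near-one (FAILURE-SIDE) companion of `pb_mean_ratio`; for gates `≥ c`, `e₁(r) ≤ (n − ΣG)/c`. [this work] -/
theorem pb_fail_odds_ratio (k : ℕ) (hk : 0 < k) (G : List ℝ) (hG : ∀ g ∈ G, 0 < g ∧ g ≤ 1) (b : ℕ) :
    ((G.length : ℝ) - b) * PB[k, G, b] ≤ (∑ m : Fin G.length, (1 - G.get m) / G.get m) * PB[k, G, b + 1] := by
  have hG0 : ∀ g ∈ G, 0 ≤ g ∧ g ≤ 1 := fun g hg => ⟨(hG g hg).1.le, (hG g hg).2⟩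
  rw [← pb_size_bias_fail k hk G b, Finset.sum_mul]
  refine Finset.sum_le_sum fun m _ => ?_
  have hgm := hG _ (List.get_mem G m)
  have hperm := perm_get_cons_eraseIdx G m
  set W : List ℝ := G.eraseIdx m with hW
  have hWg : ∀ g ∈ W, 0 ≤ g ∧ g ≤ 1 := fun g hg => hG0 g (by rw [hW] at hg; exact List.mem_of_mem_eraseIdx hg)
  -- `P_G(b+1) = (1−g_m)·P_W(b+1) + g_m·P_W(b) ≥ g_m·P_W(b)`
  have hdec : G.get m * PB[k, W, b] ≤ PB[k, G, b + 1] := by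
    rw [blobLaw_perm (hperm.map _), List.map_cons]
    have e := pb_cons_succ k (G.get m) W b
    rw [List.map_cons] at e
    rw [e]
    have := pb_nonneg k W hWg (b + 1)
    nlinarith [hgm.2]
  -- `(1−g_m)·P_W(b) ≤ ((1−g_m)/g_m)·P_G(b+1)`
  have h1 : (1 - G.get m) / G.get m * PB[k, G, b + 1] ≥ (1 - G.get m) / G.get m * (G.get m * PB[k, W, b]) :=
    mul_le_mul_of_nonneg_left hdec (div_nonneg (sub_nonneg.2 hgm.2) hgm.1.le)
  have e2 : (1 - G.get m) / G.get m * (G.get m * PB[k, W, b]) = (1 - G.get m) * PB[k, W, b] := by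
    have hg0 : G.get m ≠ 0 := hgm.1.ne'
    calc (1 - G.get m) / G.get m * (G.get m * PB[k, W, b]) = (1 - G.get m) * (G.get m / G.get m) * PB[k, W, b] := by ring
      _ = (1 - G.get m) * PB[k, W, b] := by rw [div_self hg0, mul_one]
  linarith [h1, e2]

/-- **THE FAILURE-ODDS RATIO BOUND FOR HUB MASSES**: `sHub lo K P` (`lo < K`, gates in `(0,1]`, `j = |P|`):
`(j − b)·u(lo·j + K·b) ≤ (Σᵢ (1−γᵢ)/γᵢ)·u(lo·j + K·(b+1))`. [this work] -/
theorem sHub_fail_odds_ratio (lo K : ℕ) (hloK : lo < K) (P : List ℝ) (hP : ∀ γ ∈ P, 0 < γ ∧ γ ≤ 1) (b : ℕ) :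
    ((P.length : ℝ) - b) * sHub lo K P (lo * P.length + K * b)
      ≤ (∑ m : Fin P.length, (1 - P.get m) / P.get m) * sHub lo K P (lo * P.length + K * (b + 1)) := by
  have hK : 0 < K := lt_of_le_of_lt (Nat.zero_le lo) hloK
  have hP0 : ∀ γ ∈ P, 0 ≤ γ ∧ γ ≤ 1 := fun γ hγ => ⟨(hP γ hγ).1.le, (hP γ hγ).2⟩
  rw [sHub_atom_eq_pb lo K hloK P hP0 b, sHub_atom_eq_pb lo K hloK P hP0 (b + 1)]
  exact pb_fail_odds_ratio K hK P hP b

end LawDec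
end Quant
end Summit.CriticalPhenomena.PercolationContinuityZ3.Theorems
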